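import Summits.AtomisticToContinuum.HydrodynamicLimit.Theorems.InformationPercolationEngineLocalSecondLawInitialMatchingVelocityKLTrunc

/-!
# Stub B′|ML (`stub_initialMatchingOfStatics`) of the line `contact-asymmetry-information` for the crux `LocalSecondLaw`
(stmt-AtomisticToContinuum-13081) — part 3b: the velocity relative-entropy budget of a bounded tilt at `s = 0` (Fatou)

For the local Gibbs law `P_N`, a cell `S` of positive mass, the tilt `ν = P_N(·|S)` and a one-particle density `f` of `ν`
on `[0,τ]`, write `n_S(y) = ∫ f(0,y,v) dv` and `M_y = M_{1,u₀(y),θ₀(y)}` (the local Maxwellian of the profiles).  The landed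
duality `contactB_velocityTiltBudget_bdd` (a5) says `∫∫ ψ f(0,·) ≤ log(1/P_N(S))/(N+1)` for every BOUNDED measurable velocity
tilt `ψ` with `∫ e^{ψ(y,·)} dN(u₀(y),θ₀(y)𝟙) ≤ 1`.  This file performs the truncation / normalisation / Fatou argument that
turns it into the full **velocity relative-entropy budget**

  `∫∫ f(0,y,v) log ( f(0,y,v) / (n_S(y) M_y(v)) ) dv dy ≤ log(1/P_N(S))/(N+1)`   (`kl_velocity_budget`),

including the integrability of the integrand (the conditioning lemma on the velocity side: conditioning on an event of mass
`≥ δ″` moves the one-particle VELOCITY law away from the local Maxwellians by `O(log(1/δ″)/N)` nats only).  Steps: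
* `kl_le_budget_add_of_bounded` — for any bounded measurable `c`, the normalised tilt `ψ = c − log Z`, `Z(y) = ∫ e^{c(y,v)} M_y(v) dv`,
  is admissible, whence `∫∫ c f ≤ b + ∫ n_S log Z`;
* `kl_Z_trunc_le` — for the truncation `c_K = 𝟙[f=0]·(−K) + 𝟙[f>0]·clamp_{[−K,K]} log(f/(n_S M))` one has `Z ≤ 1 + e^{−K}` at EVERY `y`
  (no Jensen: `e^{clamp L} ≤ e^{L} + e^{−K}` and `∫_{f>0} f/n_S dv ≤ 1`), so `∫∫ c_K f ≤ b + e^{−K}`;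
* `kl_velocity_budget` — `K → ∞` by Fatou against the integrable minorant `−n_S M` (`t log t ≥ −1`).

References: I. Csiszár, Ann. Probab. 3 (1975) 146–158; M. D. Donsker, S. R. S. Varadhan, Comm. Pure Appl. Math. 28 (1975) 1–47
(variational formula for the relative entropy); H. Spohn, *Large Scale Dynamics of Interacting Particles* (1991), Part I §2.3.
Lead c16 (prover-line-stmt-AtomisticToContinuum-13081-c16-0).
-/

noncomputable section

open scoped BigOperators Topology Classical MeasureTheory ENNReal InnerProductSpace
open Filter Set MeasureTheory Function
open Literature.MathematicalPhysics.KineticTheory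
open Literature.Analysis.FluidPDE
open Summit.AtomisticToContinuum.HydrodynamicLimit.Theorems.LocalSecondLawNegative
open Summit.AtomisticToContinuum.HydrodynamicLimit.Theorems.LocalSecondLawLedger
open Summit.AtomisticToContinuum.HydrodynamicLimit.Theorems.LocalSecondLawContact

namespace Summit.AtomisticToContinuum.HydrodynamicLimit.Theorems.LocalSecondLawInitialMatching

variable {N : ℕ}

/-! ### Step 3: the velocity relative-entropy budget (truncation removed by Fatou) -/

/-- The comparison density `h(y, v) = n_S(y) M_y(v)` is integrable on `𝕋³ × ℝ³` with integral `1`. -/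
theorem kl_integrable_posDensity_mul_maxwellian {θ₀ : T3 → ℝ} {u₀ : T3 → V3} (hθ : Continuous θ₀)
    (hu : Continuous u₀) (hθ0 : ∀ x, 0 < θ₀ x) {n : T3 → ℝ} (hnm : Measurable n) (hn0 : ∀ y, 0 ≤ n y)
    (hni : Integrable n) :
    Integrable (fun p : T3 × V3 => n p.1 * localMaxwellian 1 (θ₀ p.1) (u₀ p.1) p.2) ∧
      ∫ p : T3 × V3, n p.1 * localMaxwellian 1 (θ₀ p.1) (u₀ p.1) p.2 = ∫ y, n y := by
  set h : T3 × V3 → ℝ := fun p => n p.1 * localMaxwellian 1 (θ₀ p.1) (u₀ p.1) p.2 with hh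
  have hhm : Measurable h := (hnm.comp measurable_fst).mul (kl_measurable_maxwellian hθ hu)
  have hslice : ∀ y, Integrable (fun v => h (y, v)) := fun y =>
    (integrable_localMaxwellian (hθ0 y) (u₀ y)).const_mul (n y)
  have hnorm : ∀ y, ∫ v, ‖h (y, v)‖ = n y := by
    intro y
    have : (fun v => ‖h (y, v)‖) = fun v => n y * localMaxwellian 1 (θ₀ y) (u₀ y) v := by
      funext v
      rw [Real.norm_eq_abs, abs_of_nonneg (mul_nonneg (hn0 y) (localMaxwellian_nonneg zero_le_one (hθ0 y).le _ _))]
    rw [this, integral_const_mul, integral_localMaxwellian_one (hθ0 y), mul_one]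
  have hint : Integrable h ((volume : Measure T3).prod (volume : Measure V3)) := by
    rw [integrable_prod_iff hhm.aestronglyMeasurable]
    refine ⟨ae_of_all _ hslice, ?_⟩
    simp_rw [hnorm]
    exact hni
  have hint' : Integrable h := by rw [Measure.volume_eq_prod]; exact hint
  refine ⟨hint', ?_⟩
  calc ∫ p, h p = ∫ p, h p ∂((volume : Measure T3).prod (volume : Measure V3)) := by rw [← Measure.volume_eq_prod]
    _ = ∫ y, ∫ v, h (y, v) := integral_prod _ hint
    _ = ∫ y, n y := by
        refine integral_congr_ae (ae_of_all _ fun y => ?_)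
        show ∫ v, n y * localMaxwellian 1 (θ₀ y) (u₀ y) v = n y
        rw [integral_const_mul, integral_localMaxwellian_one (hθ0 y), mul_one]

/-- **The velocity relative-entropy budget of a bounded tilt (B′, velocity half of the entropy input).**  For continuous
profiles `a₀, θ₀ > 0`, `u₀`, `σ ≤ 1/2`, a cell `S` with `P_N(S) ≠ 0`, and a one-particle density `f` of `P_N(·|S)` on `[0,τ]`
(`τ ≥ 0`): with `n_S(y) = ∫ f(0,y,v) dv` and `M_y = M_{1,u₀(y),θ₀(y)}`, the function `f(0,·) log (f(0,·)/(n_S M))` is integrable on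
`𝕋³ × ℝ³` and `∫∫ f(0,y,v) log (f(0,y,v)/(n_S(y) M_y(v))) dv dy ≤ log(1/P_N(S))/(N+1)`. -/
theorem kl_velocity_budget : ∀ {a₀ θ₀ : T3 → ℝ} {u₀ : T3 → V3} (ha : Continuous a₀) (hθ : Continuous θ₀) (hu : Continuous u₀) (ha0 : ∀ x, 0 < a₀ x) (hθ0 : ∀ x, 0 < θ₀ x) {σ : ℝ}, σ ≤ 1 / 2 → ∀ {N : ℕ} {τ : ℝ}, 0 ≤ τ → ∀ (Φ : Flow σ N) (S : Set (Phase N)) (f : Pt1 → ℝ), localGibbsLaw σ a₀ u₀ θ₀ N Φ S ≠ 0 → IsOneParticleDensity τ (condLaw (localGibbsLaw σ a₀ u₀ θ₀ N Φ) S) Φ f → Integrable (fun p : T3 × V3 => f (0, p) * Real.log (f (0, p) / ((∫ v, f (0, p.1, v)) * localMaxwellian 1 (θ₀ p.1) (u₀ p.1) p.2))) ∧ ∫ p : T3 × V3, f (0, p) * Real.log (f (0, p) / ((∫ v, f (0, p.1, v)) * localMaxwellian 1 (θ₀ p.1) (u₀ p.1) p.2)) ≤ Real.log ((localGibbsLaw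 σ a₀ u₀ θ₀ N Φ S).toReal⁻¹) / (N + 1) := by
  intro a₀ θ₀ u₀ ha hθ hu ha0 hθ0 σ hσ N τ hτ Φ S f hS0 hf
  set μ : Measure (Phase N) := localGibbsLaw σ a₀ u₀ θ₀ N Φ with hμ
  haveI : IsProbabilityMeasure μ := isProbabilityMeasure_localGibbsLaw ha hθ hu ha0 hθ0 hσ N Φ
  set ν : Measure (Phase N) := condLaw μ S with hν
  haveI : IsProbabilityMeasure ν := contactB_condLaw_isProbability μ S hS0 (measure_ne_top μ S)
  set b : ℝ := Real.log ((μ S).toReal⁻¹) / (N + 1) with hb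
  -- the objects
  set F0 : T3 × V3 → ℝ := fun p => f (0, p) with hF0
  set nS : T3 → ℝ := fun y => ∫ v : V3, f (0, y, v) with hnS
  set Mf : T3 × V3 → ℝ := fun p => localMaxwellian 1 (θ₀ p.1) (u₀ p.1) p.2 with hMf
  set L : T3 × V3 → ℝ := fun p => Real.log (F0 p / (nS p.1 * Mf p)) with hL
  set h : T3 × V3 → ℝ := fun p => nS p.1 * Mf p with hh
  have hF0m : Measurable F0 := tv_measurable_slice_zero hf
  have hnSm : Measurable nS := tv_measurable_posDensity hf
  have hMfm : Measurable Mf := kl_measurable_maxwellian hθ hu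
  have hLm : Measurable L := Real.measurable_log.comp (hF0m.div ((hnSm.comp measurable_fst).mul hMfm))
  have hF00 : ∀ p, 0 ≤ F0 p := fun p => hf.1 _
  have hnS0 : ∀ y, 0 ≤ nS y := fun y => tv_posDensity_nonneg hf y
  have hMfpos : ∀ p, 0 < Mf p := fun p => localMaxwellian_pos one_pos (hθ0 p.1) _ _
  have hnSi : Integrable nS := tv_integrable_posDensity ν Φ f hτ hf
  obtain ⟨hhi, hh1⟩ := kl_integrable_posDensity_mul_maxwellian hθ hu hθ0 hnSm hnS0 hnSi
  rw [tv_integral_posDensity ν Φ f hτ hf] at hh1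
  -- pointwise minorant
  have hmin : ∀ p, -(h p) ≤ F0 p * L p := fun p => (kl_mul_log_ratio_ge (hF00 p) (hnS0 p.1) (hMfpos p)).1
  -- the truncations
  set c : ℕ → T3 × V3 → ℝ := fun m p => if F0 p = 0 then -(m : ℝ) else max (-(m : ℝ)) (min (L p) m) with hc
  have hcm : ∀ m, Measurable (c m) := fun m =>
    Measurable.ite (measurableSet_eq_fun hF0m measurable_const) measurable_const
      (measurable_const.max (hLm.min measurable_const))
  have hcb : ∀ m p, |c m p| ≤ m := by
    intro m p
    rw [hc]; dsimp only
    split_ifs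
    · rw [abs_neg, abs_of_nonneg (Nat.cast_nonneg m)]
    · rw [abs_le]
      exact ⟨le_max_left _ _, max_le (by linarith [(Nat.cast_nonneg m : (0 : ℝ) ≤ m)]) (min_le_right _ _)⟩
  have hcmin : ∀ m p, -(h p) ≤ c m p * F0 p := by
    intro m p
    have hh0 : 0 ≤ h p := mul_nonneg (hnS0 p.1) (hMfpos p).le
    rw [hc]; dsimp only
    split_ifs with hz
    · rw [hz, mul_zero]; linarith
    · have hFp : 0 < F0 p := lt_of_le_of_ne (hF00 p) (Ne.symm hz)
      by_cases hL0 : 0 ≤ L p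
      · have : 0 ≤ max (-(m : ℝ)) (min (L p) m) := le_max_of_le_right (le_min hL0 (Nat.cast_nonneg m))
        nlinarith
      · push Not at hL0
        have e1 : min (L p) m = L p := min_eq_left (hL0.le.trans (Nat.cast_nonneg m))
        rw [e1]
        have e2 : L p ≤ max (-(m : ℝ)) (L p) := le_max_right _ _
        have e3 : L p * F0 p ≤ max (-(m : ℝ)) (L p) * F0 p := mul_le_mul_of_nonneg_right e2 hFp.le
        linarith [hmin p, mul_comm (F0 p) (L p)]
  -- (i) the budget of every truncation
  have hbud : ∀ m : ℕ, ∫ p, c m p * F0 p ≤ b + Real.exp (-(m : ℝ)) := by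
    intro m
    have h1 := kl_le_budget_add_of_bounded ha hθ hu ha0 hθ0 hσ hτ Φ S f hS0 hf (hcm m) (hcb m)
    -- `Z ≤ 1 + e^{-m}` at every `y`
    have h2 : ∀ y : T3, (∫ v, Real.exp (c m (y, v)) * localMaxwellian 1 (θ₀ y) (u₀ y) v) ≤ 1 + Real.exp (-(m : ℝ)) :=
      fun y => kl_Z_trunc_le (hθ0 y) (u₀ y) (F := fun v => f (0, y, v))
        (hF0m.comp (measurable_const.prodMk measurable_id)) (fun v => hf.1 _) (Nat.cast_nonneg m)
    have hZpos : ∀ y : T3, 0 < ∫ v, Real.exp (c m (y, v)) * localMaxwellian 1 (θ₀ y) (u₀ y) v :=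
      fun y => (Real.exp_pos _).trans_le (kl_Z_mem (u₀ := u₀) hθ0 (hcm m) (hcb m) y).1
    have hZm : Measurable fun y : T3 => ∫ v, Real.exp (c m (y, v)) * localMaxwellian 1 (θ₀ y) (u₀ y) v :=
      kl_measurable_Z hθ hu (hcm m)
    have h3 : ∫ y, nS y * Real.log (∫ v, Real.exp (c m (y, v)) * localMaxwellian 1 (θ₀ y) (u₀ y) v) ≤
        Real.exp (-(m : ℝ)) := by
      have hpt : ∀ y, nS y * Real.log (∫ v, Real.exp (c m (y, v)) * localMaxwellian 1 (θ₀ y) (u₀ y) v) ≤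
          nS y * Real.exp (-(m : ℝ)) := by
        intro y
        refine mul_le_mul_of_nonneg_left ?_ (hnS0 y)
        have := Real.log_le_sub_one_of_pos (hZpos y)
        linarith [h2 y]
      have hlogb : ∀ y, |Real.log (∫ v, Real.exp (c m (y, v)) * localMaxwellian 1 (θ₀ y) (u₀ y) v)| ≤ m := by
        intro y
        obtain ⟨hlo, hhi⟩ := kl_Z_mem (u₀ := u₀) hθ0 (hcm m) (hcb m) y
        rw [abs_le]
        constructor
        · have := Real.log_le_log (Real.exp_pos _) hlo
          rwa [Real.log_exp] at this
        · have := Real.log_le_log (hZpos y) hhi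
          rwa [Real.log_exp] at this
      have hi1 : Integrable fun y => nS y * Real.log (∫ v, Real.exp (c m (y, v)) * localMaxwellian 1 (θ₀ y) (u₀ y) v) :=
        hnSi.mul_bdd (Real.measurable_log.comp hZm).aestronglyMeasurable
          (ae_of_all _ fun y => by rw [Real.norm_eq_abs]; exact hlogb y)
      calc ∫ y, nS y * Real.log (∫ v, Real.exp (c m (y, v)) * localMaxwellian 1 (θ₀ y) (u₀ y) v)
          ≤ ∫ y, nS y * Real.exp (-(m : ℝ)) := integral_mono hi1 (hnSi.mul_const _) hpt
        _ = Real.exp (-(m : ℝ)) := by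
            rw [integral_mul_const, tv_integral_posDensity ν Φ f hτ hf, one_mul]
    linarith
  -- (ii) pointwise convergence of the truncations
  have hconv : ∀ p, Tendsto (fun m : ℕ => c m p * F0 p) atTop (𝓝 (F0 p * L p)) := by
    intro p
    refine tendsto_atTop_of_eventually_const (i₀ := Nat.ceil |L p|) fun m hm => ?_
    rw [hc]; dsimp only
    split_ifs with hz
    · rw [hz, mul_zero, zero_mul]
    · have hmL : |L p| ≤ m := (Nat.le_ceil _).trans (by exact_mod_cast hm)
      rw [min_eq_left (abs_le.1 hmL).2, max_eq_right (abs_le.1 hmL).1, mul_comm]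
  -- (iii) Fatou
  set G : ℕ → T3 × V3 → ℝ≥0∞ := fun m p => ENNReal.ofReal (c m p * F0 p + h p) with hG
  have hGm : ∀ m, Measurable (G m) := fun m =>
    (((hcm m).mul hF0m).add ((hnSm.comp measurable_fst).mul hMfm)).ennreal_ofReal
  have hlim : ∀ p, Tendsto (fun m => G m p) atTop (𝓝 (ENNReal.ofReal (F0 p * L p + h p))) := fun p =>
    (ENNReal.continuous_ofReal.tendsto _).comp ((hconv p).add_const _)
  have hliminf : (fun p => liminf (fun m => G m p) atTop) = fun p => ENNReal.ofReal (F0 p * L p + h p) :=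
    funext fun p => (hlim p).liminf_eq
  have hFatou := lintegral_liminf_le (μ := (volume : Measure (T3 × V3))) (f := G) (u := atTop) hGm
  rw [hliminf] at hFatou
  have hci : ∀ m, Integrable fun p => c m p * F0 p := fun m =>
    (tv_integrable_slice_zero ν Φ f hτ hf).bdd_mul (hcm m).aestronglyMeasurable
      (ae_of_all _ fun p => by rw [Real.norm_eq_abs]; exact hcb m p)
  have hGint : ∀ m, ∫⁻ p, G m p = ENNReal.ofReal (∫ p, (c m p * F0 p + h p)) := fun m =>
    (ofReal_integral_eq_lintegral_ofReal ((hci m).add hhi)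
      (ae_of_all _ fun p => by
        have h1 := hcmin m p
        simp only [hh, hMf] at h1
        simp only [Pi.add_apply, Pi.zero_apply]
        linarith)).symm
  have hGle : ∀ m, ∫⁻ p, G m p ≤ ENNReal.ofReal (b + 1 + Real.exp (-(m : ℝ))) := by
    intro m
    rw [hGint m, integral_add (hci m) hhi, hh1]
    exact ENNReal.ofReal_le_ofReal (by linarith [hbud m])
  have htend : Tendsto (fun m : ℕ => ENNReal.ofReal (b + 1 + Real.exp (-(m : ℝ)))) atTop
      (𝓝 (ENNReal.ofReal (b + 1))) := by
    have h1 : Tendsto (fun m : ℕ => b + 1 + Real.exp (-(m : ℝ))) atTop (𝓝 (b + 1 + 0)) :=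
      tendsto_const_nhds.add (Real.tendsto_exp_neg_atTop_nhds_zero.comp tendsto_natCast_atTop_atTop)
    rw [add_zero] at h1
    exact (ENNReal.continuous_ofReal.tendsto _).comp h1
  have hbound : ∫⁻ p, ENNReal.ofReal (F0 p * L p + h p) ≤ ENNReal.ofReal (b + 1) := by
    refine hFatou.trans ?_
    rw [← htend.liminf_eq]
    exact liminf_le_liminf (Eventually.of_forall hGle)
  -- (iv) integrability of the limit and the bound
  have hgm : Measurable fun p => F0 p * L p + h p := (hF0m.mul hLm).add ((hnSm.comp measurable_fst).mul hMfm)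
  have hg0 : ∀ p, 0 ≤ F0 p * L p + h p := fun p => by linarith [hmin p]
  have hgi : Integrable fun p => F0 p * L p + h p := by
    refine ⟨hgm.aestronglyMeasurable, ?_⟩
    rw [hasFiniteIntegral_iff_ofReal (ae_of_all _ hg0)]
    exact hbound.trans_lt ENNReal.ofReal_lt_top
  have hFLi : Integrable fun p => F0 p * L p := by
    have := hgi.sub hhi
    refine this.congr (ae_of_all _ fun p => ?_)
    show F0 p * L p + h p - h p = F0 p * L p
    ring
  refine ⟨hFLi, ?_⟩
  have hb0 : 0 ≤ b := by
    rw [hb]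
    refine div_nonneg (Real.log_nonneg ?_) (by positivity)
    have h1 : (μ S).toReal ≤ 1 := by
      have := prob_le_one (μ := μ) (s := S)
      exact ENNReal.toReal_mono ENNReal.one_ne_top this |>.trans_eq ENNReal.toReal_one
    have h2 : 0 < (μ S).toReal := ENNReal.toReal_pos hS0 (measure_ne_top μ S)
    exact (one_le_inv₀ h2).2 h1
  have hint_le : ∫ p, (F0 p * L p + h p) ≤ b + 1 := by
    rw [integral_eq_lintegral_of_nonneg_ae (ae_of_all _ hg0) hgm.aestronglyMeasurable]
    have := ENNReal.toReal_mono ENNReal.ofReal_ne_top hbound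
    rwa [ENNReal.toReal_ofReal (by linarith)] at this
  rw [integral_add hFLi hhi, hh1] at hint_le
  show ∫ p, F0 p * L p ≤ b
  linarith

end Summit.AtomisticToContinuum.HydrodynamicLimit.Theorems.LocalSecondLawInitialMatching

end
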